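import Summits.AtomisticToContinuum.HydrodynamicLimit.Theorems.OneFlightGossipEngineEquilibriumStressVarianceDecayWindows
import Summits.AtomisticToContinuum.HydrodynamicLimit.Theorems.BoltzmannGreenKubo.Negative.WindowCovariance

/-!
# The Green–Kubo / Fejér identity for the kinetic-window variance of an `L²` observable (helper file
# for `OneFlightGossipEngine.EquilibriumStressVarianceDecay`, stmt-AtomisticToContinuum-9531)

Frame: the homogeneous (constant-profile) local Gibbs law `G_N = localGibbsLaw σ c u θ N Φ` of `N + 1` hard
spheres (a probability measure, invariant under every `Φ_t`:
`BoltzmannGreenKuboOrthMomentum.measurePreserving_flow_localGibbsLaw`), a hard-sphere flow `Φ`, and a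
measurable SQUARE-INTEGRABLE phase function `X ∈ L²(G_N)` (the kinetic shear stress `Σᵢ φ(xᵢ) vᵢ⁰vᵢ¹` of the
item is unbounded, so the bounded-observable identity
`BoltzmannGreenKuboWindowCovariance.integral_sq_window_eq_single` does not apply to it). With the stationary
autocorrelation `C(t) = ∫ X(z) X(Φ_t z) dG_N`:

* `integral_flow_mul_flow_sub` / `integral_flow_mul_flow_abs` — two-time stationarity
  `∫ X(Φ_r z) X(Φ_{r'} z) dG_N = C(r' − r) = C(|r' − r|)` (group property on the good set + invariance);
* `abs_corr_le_integral_sq` — `|C(t)| ≤ ∫ X² dG_N`; `measurable_corr` — `t ↦ C(t)` is measurable;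
* `integral_sq_window_eq_fejer` — **THE WINDOW-VARIANCE IDENTITY** (`L²` version):
  `∫ (∫₀ʰ X(Φ_r z) dr)² dG_N = 2 ∫₀ʰ (h − t) C(t) dt` (two Fubinis on `G_N ⊗ [0,h]` with AM–GM domination,
  stationarity pointwise, triangle reduction `∫₀ʰ∫₀ʰ C(|s−r|) = 2∫₀ʰ(h−t)C(t)`);
* `lintegral_sq_windowAvg_eq_fejer` — the same for the window AVERAGE in the `ℝ≥0∞` shape of the item:
  `∫⁻ ofReal((h⁻¹∫₀ʰ X(Φ_r z) dr)²) dG_N = ofReal(2 h⁻² ∫₀ʰ (h − t) C(t) dt)` (Fejér mean of `C`);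
* `lintegral_sq_windowAvg_le_cesaro_abs_corr` — the Green–Kubo INEQUALITY
  `∫⁻ ofReal((h⁻¹∫₀ʰ X(Φ_r z) dr)²) dG_N ≤ ofReal(2 h⁻¹ ∫₀ʰ |C(t)| dt)` (Cesàro mean of `|C|`).

No positivity of `σ` and no dynamics beyond the `HardSphereFlow` axioms are used. The stress instantiation
(reformulation of item 9531 as the Fejér-mean decay of the `N`-uniform stress autocorrelation, and its reduction
to Cesàro decay of `|C_N|`, the docking point of the route's gossip engine) is the companion file
`…EquilibriumStressVarianceDecayCorrDecay`. References: the module docstrings of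
`Theorems/BoltzmannGreenKubo/Negative/{TimeAverage,Stationarity,WindowCovariance}.lean`; H. Spohn, *Large Scale
Dynamics of Interacting Particles* (1991), Part II §1.7 (Green–Kubo formulae, time-displaced correlations in
equilibrium).
-/

noncomputable section

namespace Summit.AtomisticToContinuum.HydrodynamicLimit.Theorems

open MeasureTheory ProbabilityTheory Filter Topology Set
open Literature.Analysis.FluidPDE Literature.MathematicalPhysics.KineticTheory
open scoped InnerProductSpace ENNReal
open BoltzmannGreenKuboOrthMomentum BoltzmannGreenKuboWindowCovariance

namespace EquilibriumStressVarianceDecayC3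

section Stationarity

variable {σ : ℝ} {N : ℕ}

/-- **Two-time stationarity**: `∫ X(Φ_r z) X(Φ_{r'} z) dG_N = ∫ X(z) X(Φ_{r'−r} z) dG_N` for all real
`r, r'` (group property on the good set and invariance of `G_N` under `Φ_r`). [folklore] -/
theorem integral_flow_mul_flow_sub (c θ : ℝ) (u : V3)
    (Φ : HardSphereFlow (Torus.geometry (Fin 3)) (hsDiameter σ N) (N + 1))
    {X : Config (N + 1) (Fin 3) T3 → ℝ} (hX : Measurable X) (r r' : ℝ) :
    ∫ z, X (Φ.flow r z) * X (Φ.flow r' z) ∂(localGibbsLaw σ (fun _ => c) (fun _ => u) (fun _ => θ) N Φ) =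
      ∫ z, X z * X (Φ.flow (r' - r) z) ∂(localGibbsLaw σ (fun _ => c) (fun _ => u) (fun _ => θ) N Φ) := by
  set G := localGibbsLaw σ (fun _ => c) (fun _ => u) (fun _ => θ) N Φ with hGdef
  have hae : (fun z => X (Φ.flow r z) * X (Φ.flow r' z)) =ᵐ[G]
      fun z => (fun w => X w * X (Φ.flow (r' - r) w)) (Φ.flow r z) := by
    filter_upwards [ae_mem_good_localGibbsLaw' (N := N) c θ u Φ] with z hz
    have key : Φ.flow r' z = Φ.flow (r' - r) (Φ.flow r z) := by
      have := Φ.flow_add (r' - r) r z hz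
      rwa [sub_add_cancel] at this
    simp only [key]
  rw [integral_congr_ae hae]
  have hF : AEStronglyMeasurable (fun w => X w * X (Φ.flow (r' - r) w)) (G.map (Φ.flow r)) :=
    (hX.mul (hX.comp (Φ.measurable_flow _))).aestronglyMeasurable
  have h := integral_map (Φ.measurable_flow r).aemeasurable hF
  rw [(measurePreserving_flow_localGibbsLaw c θ u Φ r).map_eq] at h
  exact h.symm

/-- **The stationary autocorrelation is even**: `∫ X(z) X(Φ_{−t} z) dG_N = ∫ X(z) X(Φ_t z) dG_N`.
[folklore] -/
theorem integral_mul_flow_neg (c θ : ℝ) (u : V3)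
    (Φ : HardSphereFlow (Torus.geometry (Fin 3)) (hsDiameter σ N) (N + 1))
    {X : Config (N + 1) (Fin 3) T3 → ℝ} (hX : Measurable X) (t : ℝ) :
    ∫ z, X z * X (Φ.flow (-t) z) ∂(localGibbsLaw σ (fun _ => c) (fun _ => u) (fun _ => θ) N Φ) =
      ∫ z, X z * X (Φ.flow t z) ∂(localGibbsLaw σ (fun _ => c) (fun _ => u) (fun _ => θ) N Φ) := by
  have h1 := integral_flow_mul_flow_sub c θ u Φ hX t 0
  have h2 := integral_flow_mul_flow_sub c θ u Φ hX 0 t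
  rw [zero_sub] at h1
  rw [sub_zero] at h2
  rw [← h1, ← h2]
  simp_rw [mul_comm (X (Φ.flow t _))]

/-- **Two-time stationarity, normal form**: `∫ X(Φ_r z) X(Φ_{r'} z) dG_N = C(|r' − r|)`,
`C(t) = ∫ X(z) X(Φ_t z) dG_N`. [folklore] -/
theorem integral_flow_mul_flow_abs (c θ : ℝ) (u : V3)
    (Φ : HardSphereFlow (Torus.geometry (Fin 3)) (hsDiameter σ N) (N + 1))
    {X : Config (N + 1) (Fin 3) T3 → ℝ} (hX : Measurable X) (r r' : ℝ) :
    ∫ z, X (Φ.flow r z) * X (Φ.flow r' z) ∂(localGibbsLaw σ (fun _ => c) (fun _ => u) (fun _ => θ) N Φ) =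
      ∫ z, X z * X (Φ.flow |r' - r| z) ∂(localGibbsLaw σ (fun _ => c) (fun _ => u) (fun _ => θ) N Φ) := by
  rw [integral_flow_mul_flow_sub c θ u Φ hX r r']
  rcases le_total r r' with h | h
  · rw [abs_of_nonneg (sub_nonneg.2 h)]
  · rw [abs_of_nonpos (sub_nonpos.2 h), integral_mul_flow_neg c θ u Φ hX]

/-- `(X ∘ Φ_t)² ∈ L¹(G_N)` for `X ∈ L²(G_N)` (invariance of `G_N`). [folklore] -/
theorem integrable_sq_comp_flow (c θ : ℝ) (u : V3)
    (Φ : HardSphereFlow (Torus.geometry (Fin 3)) (hsDiameter σ N) (N + 1))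
    {X : Config (N + 1) (Fin 3) T3 → ℝ} (hX : Measurable X)
    (hX2 : MemLp X 2 (localGibbsLaw σ (fun _ => c) (fun _ => u) (fun _ => θ) N Φ)) (t : ℝ) :
    Integrable (fun z => X (Φ.flow t z) ^ 2) (localGibbsLaw σ (fun _ => c) (fun _ => u) (fun _ => θ) N Φ) :=
  ((measurePreserving_flow_localGibbsLaw c θ u Φ t).integrable_comp
    (hX.pow_const 2).aestronglyMeasurable).2 hX2.integrable_sq

/-- `∫ (X ∘ Φ_t)² dG_N = ∫ X² dG_N` (invariance of `G_N`). [folklore] -/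
theorem integral_sq_comp_flow (c θ : ℝ) (u : V3)
    (Φ : HardSphereFlow (Torus.geometry (Fin 3)) (hsDiameter σ N) (N + 1))
    {X : Config (N + 1) (Fin 3) T3 → ℝ} (hX : Measurable X) (t : ℝ) :
    ∫ z, X (Φ.flow t z) ^ 2 ∂(localGibbsLaw σ (fun _ => c) (fun _ => u) (fun _ => θ) N Φ) =
      ∫ z, X z ^ 2 ∂(localGibbsLaw σ (fun _ => c) (fun _ => u) (fun _ => θ) N Φ) := by
  set G := localGibbsLaw σ (fun _ => c) (fun _ => u) (fun _ => θ) N Φ with hGdef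
  have h := integral_map (Φ.measurable_flow t).aemeasurable
    (((hX.pow_const 2)).aestronglyMeasurable (μ := G.map (Φ.flow t)))
  rw [(measurePreserving_flow_localGibbsLaw c θ u Φ t).map_eq] at h
  exact h.symm

/-- **The autocorrelation never exceeds the static second moment**: `|∫ X · X∘Φ_t dG_N| ≤ ∫ X² dG_N`
(`|ab| ≤ (a² + b²)/2` and invariance). [folklore] -/
theorem abs_corr_le_integral_sq (c θ : ℝ) (u : V3)
    (Φ : HardSphereFlow (Torus.geometry (Fin 3)) (hsDiameter σ N) (N + 1))
    {X : Config (N + 1) (Fin 3) T3 → ℝ} (hX : Measurable X)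
    (hX2 : MemLp X 2 (localGibbsLaw σ (fun _ => c) (fun _ => u) (fun _ => θ) N Φ)) (t : ℝ) :
    |∫ z, X z * X (Φ.flow t z) ∂(localGibbsLaw σ (fun _ => c) (fun _ => u) (fun _ => θ) N Φ)| ≤
      ∫ z, X z ^ 2 ∂(localGibbsLaw σ (fun _ => c) (fun _ => u) (fun _ => θ) N Φ) := by
  set G := localGibbsLaw σ (fun _ => c) (fun _ => u) (fun _ => θ) N Φ with hGdef
  have h1 : Integrable (fun z => X z ^ 2) G := hX2.integrable_sq
  have h2 := integrable_sq_comp_flow c θ u Φ hX hX2 t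
  calc |∫ z, X z * X (Φ.flow t z) ∂G|
      ≤ ∫ z, |X z * X (Φ.flow t z)| ∂G := abs_integral_le_integral_abs
    _ ≤ ∫ z, (X z ^ 2 + X (Φ.flow t z) ^ 2) / 2 ∂G := by
        refine integral_mono_of_nonneg (Eventually.of_forall fun z => abs_nonneg _) ((h1.add h2).div_const 2)
          (Eventually.of_forall fun z => ?_)
        show |X z * X (Φ.flow t z)| ≤ (X z ^ 2 + X (Φ.flow t z) ^ 2) / 2
        rw [abs_mul]
        nlinarith [sq_nonneg (|X z| - |X (Φ.flow t z)|), sq_abs (X z), sq_abs (X (Φ.flow t z))]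
    _ = ∫ z, X z ^ 2 ∂G := by
        rw [integral_div, integral_add h1 h2, integral_sq_comp_flow c θ u Φ hX t]
        ring

/-- `t ↦ C(t) = ∫ X · X∘Φ_t dG_N` is measurable (Bochner integral of the jointly measurable modification
`flowMod` of the flow, which is the flow at every good datum). [folklore] -/
theorem measurable_corr (c θ : ℝ) (u : V3)
    (Φ : HardSphereFlow (Torus.geometry (Fin 3)) (hsDiameter σ N) (N + 1))
    [IsProbabilityMeasure (localGibbsLaw σ (fun _ => c) (fun _ => u) (fun _ => θ) N Φ)]
    {X : Config (N + 1) (Fin 3) T3 → ℝ} (hX : Measurable X) :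
    Measurable fun t => ∫ z, X z * X (Φ.flow t z) ∂(localGibbsLaw σ (fun _ => c) (fun _ => u) (fun _ => θ) N Φ) := by
  set G := localGibbsLaw σ (fun _ => c) (fun _ => u) (fun _ => θ) N Φ with hGdef
  have hM : Measurable fun p : ℝ × Config (N + 1) (Fin 3) T3 => X p.2 * X (flowMod Φ p) :=
    (hX.comp measurable_snd).mul (hX.comp (measurable_flowMod Φ))
  have hS : StronglyMeasurable fun t => ∫ z, X z * X (flowMod Φ (t, z)) ∂G :=
    hM.stronglyMeasurable.integral_prod_right'
  have heq : (fun t => ∫ z, X z * X (Φ.flow t z) ∂G) = fun t => ∫ z, X z * X (flowMod Φ (t, z)) ∂G := by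
    funext t
    refine integral_congr_ae ?_
    filter_upwards [ae_mem_good_localGibbsLaw' (N := N) c θ u Φ] with z hz
    rw [flowMod_of_mem Φ hz]
  rw [heq]
  exact hS.measurable

end Stationarity

section Fejer

variable {σ : ℝ} {N : ℕ}

/-- The autocorrelation kernel with one time frozen, `(r, z) ↦ X(Φ_r z) · X(Φ_s z)`, is integrable on
`[0, h] × G_N` for `X ∈ L²(G_N)` (AM–GM domination by `X(Φ_r z)² + X(Φ_s z)²`). [folklore] -/
theorem integrable_prod_flow_mul_flow (c θ : ℝ) (u : V3)
    (Φ : HardSphereFlow (Torus.geometry (Fin 3)) (hsDiameter σ N) (N + 1))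
    [IsProbabilityMeasure (localGibbsLaw σ (fun _ => c) (fun _ => u) (fun _ => θ) N Φ)]
    {X : Config (N + 1) (Fin 3) T3 → ℝ} (hX : Measurable X)
    (hX2 : MemLp X 2 (localGibbsLaw σ (fun _ => c) (fun _ => u) (fun _ => θ) N Φ)) (h s : ℝ) :
    Integrable (fun p : ℝ × Config (N + 1) (Fin 3) T3 => X (Φ.flow p.1 p.2) * X (Φ.flow s p.2))
      ((volume.restrict (Ioc (0 : ℝ) h)).prod (localGibbsLaw σ (fun _ => c) (fun _ => u) (fun _ => θ) N Φ)) := by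
  set G := localGibbsLaw σ (fun _ => c) (fun _ => u) (fun _ => θ) N Φ with hGdef
  haveI : IsFiniteMeasure (volume.restrict (Ioc (0 : ℝ) h)) := ⟨by simp [Real.volume_Ioc]⟩
  have hflow2 := integrable_comp_flow_prod c θ u Φ (hX.pow_const 2) hX2.integrable_sq h
  have hflow1 := integrable_comp_flow_prod c θ u Φ hX (hX2.integrable one_le_two) h
  have hstat : Integrable (fun p : ℝ × Config (N + 1) (Fin 3) T3 => X (Φ.flow s p.2) ^ 2)
      ((volume.restrict (Ioc (0 : ℝ) h)).prod G) := by
    simpa using (integrable_const (1 : ℝ)).mul_prod (integrable_sq_comp_flow c θ u Φ hX hX2 s)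
  have hgm : AEStronglyMeasurable (fun p : ℝ × Config (N + 1) (Fin 3) T3 => X (Φ.flow s p.2))
      ((volume.restrict (Ioc (0 : ℝ) h)).prod G) :=
    ((hX.comp ((Φ.measurable_flow s).comp measurable_snd))).aestronglyMeasurable
  have hdom : Integrable (fun p : ℝ × Config (N + 1) (Fin 3) T3 =>
      (X (Φ.flow p.1 p.2) ^ 2 + X (Φ.flow s p.2) ^ 2) / 2) ((volume.restrict (Ioc (0 : ℝ) h)).prod G) :=
    (hflow2.add hstat).div_const 2
  refine hdom.mono' (hflow1.aestronglyMeasurable.mul hgm) (Eventually.of_forall fun p => ?_)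
  rw [Real.norm_eq_abs, abs_mul]
  nlinarith [sq_nonneg (|X (Φ.flow p.1 p.2)| - |X (Φ.flow s p.2)|), sq_abs (X (Φ.flow p.1 p.2)),
    sq_abs (X (Φ.flow s p.2)), abs_nonneg (X (Φ.flow p.1 p.2)), abs_nonneg (X (Φ.flow s p.2))]

/-- The window integral of an `L²` observable is square integrable:
`z ↦ (∫₀ʰ X(Φ_r z) dr)² ∈ L¹(G_N)` (Cauchy–Schwarz in time along a.e. orbit + stationary time averages).
[folklore] -/
theorem integrable_sq_window (c θ : ℝ) (u : V3)
    (Φ : HardSphereFlow (Torus.geometry (Fin 3)) (hsDiameter σ N) (N + 1))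
    [IsProbabilityMeasure (localGibbsLaw σ (fun _ => c) (fun _ => u) (fun _ => θ) N Φ)]
    {X : Config (N + 1) (Fin 3) T3 → ℝ} (hX : Measurable X)
    (hX2 : MemLp X 2 (localGibbsLaw σ (fun _ => c) (fun _ => u) (fun _ => θ) N Φ)) {h : ℝ} (hh : 0 ≤ h) :
    Integrable (fun z => (∫ r in (0 : ℝ)..h, X (Φ.flow r z)) ^ 2)
      (localGibbsLaw σ (fun _ => c) (fun _ => u) (fun _ => θ) N Φ) := by
  set G := localGibbsLaw σ (fun _ => c) (fun _ => u) (fun _ => θ) N Φ with hGdef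
  have hXi : Integrable X G := hX2.integrable one_le_two
  have hX2m : Measurable fun w => X w ^ 2 := hX.pow_const 2
  have hX2i : Integrable (fun w => X w ^ 2) G := hX2.integrable_sq
  have hsec : ∀ᵐ z ∂G, Integrable (fun r => X (Φ.flow r z)) (volume.restrict (Ioc (0 : ℝ) h)) :=
    (integrable_comp_flow_prod c θ u Φ hX hXi h).prod_left_ae
  have hsec2 : ∀ᵐ z ∂G, Integrable (fun r => X (Φ.flow r z) ^ 2) (volume.restrict (Ioc (0 : ℝ) h)) :=
    (integrable_comp_flow_prod c θ u Φ hX2m hX2i h).prod_left_ae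
  have hwin : Integrable (fun z => ∫ r in (0 : ℝ)..h, X (Φ.flow r z)) G := integrable_window c θ u Φ hX hXi hh
  have hwin2 : Integrable (fun z => ∫ r in (0 : ℝ)..h, X (Φ.flow r z) ^ 2) G :=
    integrable_window c θ u Φ hX2m hX2i hh
  refine (hwin2.const_mul h).mono' (hwin.aestronglyMeasurable.pow 2) ?_
  filter_upwards [hsec, hsec2] with z hz hz2
  rw [Real.norm_eq_abs, abs_of_nonneg (sq_nonneg _)]
  exact sq_integral_le_mul_integral_sq hh ((intervalIntegrable_iff_integrableOn_Ioc_of_le hh).2 hz)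
    ((intervalIntegrable_iff_integrableOn_Ioc_of_le hh).2 hz2)

/-- **Inner Fubini**: `∫ (∫₀ʰ X(Φ_r z) dr) X(Φ_s z) dG_N = ∫₀ʰ C(|s − r|) dr`. [folklore] -/
theorem integral_window_mul_flow_eq (c θ : ℝ) (u : V3)
    (Φ : HardSphereFlow (Torus.geometry (Fin 3)) (hsDiameter σ N) (N + 1))
    [IsProbabilityMeasure (localGibbsLaw σ (fun _ => c) (fun _ => u) (fun _ => θ) N Φ)]
    {X : Config (N + 1) (Fin 3) T3 → ℝ} (hX : Measurable X)
    (hX2 : MemLp X 2 (localGibbsLaw σ (fun _ => c) (fun _ => u) (fun _ => θ) N Φ)) {h : ℝ} (hh : 0 ≤ h) (s : ℝ) :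
    ∫ z, (∫ r in (0 : ℝ)..h, X (Φ.flow r z)) * X (Φ.flow s z) ∂(localGibbsLaw σ (fun _ => c) (fun _ => u) (fun _ => θ) N Φ) =
      ∫ r in (0 : ℝ)..h, ∫ z, X z * X (Φ.flow |s - r| z) ∂(localGibbsLaw σ (fun _ => c) (fun _ => u) (fun _ => θ) N Φ) := by
  set G := localGibbsLaw σ (fun _ => c) (fun _ => u) (fun _ => θ) N Φ with hGdef
  have e1 : (fun z => (∫ r in (0 : ℝ)..h, X (Φ.flow r z)) * X (Φ.flow s z)) =
      fun z => ∫ r in (0 : ℝ)..h, X (Φ.flow r z) * X (Φ.flow s z) := by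
    funext z
    rw [← intervalIntegral.integral_mul_const]
  have hint' : Integrable (Function.uncurry fun (z : Config (N + 1) (Fin 3) T3) (r : ℝ) =>
      X (Φ.flow r z) * X (Φ.flow s z)) (G.prod (volume.restrict (Ioc (0 : ℝ) h))) :=
    (integrable_prod_flow_mul_flow c θ u Φ hX hX2 h s).swap
  rw [e1]
  simp only [intervalIntegral.integral_of_le hh]
  rw [integral_integral_swap hint']
  refine setIntegral_congr_fun measurableSet_Ioc fun r _ => ?_
  exact integral_flow_mul_flow_abs c θ u Φ hX r s

/-- **THE WINDOW-VARIANCE IDENTITY (`L²` observable).** For `G_N` a probability measure, `X ∈ L²(G_N)`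
measurable and `h ≥ 0`: `∫ (∫₀ʰ X(Φ_r z) dr)² dG_N = 2 ∫₀ʰ (h − t) C(t) dt`, `C(t) = ∫ X(z) X(Φ_t z) dG_N` —
the kernel-checked form of `E[(∫₀ʰ X∘Φ_r)²] = ∫₀ʰ∫₀ʰ C(|s − r|) = 2∫₀ʰ (h − t) C(t) dt`. [folklore] -/
theorem integral_sq_window_eq_fejer (c θ : ℝ) (u : V3)
    (Φ : HardSphereFlow (Torus.geometry (Fin 3)) (hsDiameter σ N) (N + 1))
    [IsProbabilityMeasure (localGibbsLaw σ (fun _ => c) (fun _ => u) (fun _ => θ) N Φ)]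
    {X : Config (N + 1) (Fin 3) T3 → ℝ} (hX : Measurable X)
    (hX2 : MemLp X 2 (localGibbsLaw σ (fun _ => c) (fun _ => u) (fun _ => θ) N Φ)) {h : ℝ} (hh : 0 ≤ h) :
    ∫ z, (∫ r in (0 : ℝ)..h, X (Φ.flow r z)) ^ 2 ∂(localGibbsLaw σ (fun _ => c) (fun _ => u) (fun _ => θ) N Φ) =
      2 * ∫ t in (0 : ℝ)..h, (h - t) * ∫ z, X z * X (Φ.flow t z)
        ∂(localGibbsLaw σ (fun _ => c) (fun _ => u) (fun _ => θ) N Φ) := by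
  set G := localGibbsLaw σ (fun _ => c) (fun _ => u) (fun _ => θ) N Φ with hGdef
  haveI : IsFiniteMeasure (volume.restrict (Ioc (0 : ℝ) h)) := ⟨by simp [Real.volume_Ioc]⟩
  set A : Config (N + 1) (Fin 3) T3 → ℝ := fun z => ∫ r in (0 : ℝ)..h, X (Φ.flow r z) with hAdef
  set C : ℝ → ℝ := fun t => ∫ z, X z * X (Φ.flow t z) ∂G with hCdef
  have hAi : Integrable A G := integrable_window c θ u Φ hX (hX2.integrable one_le_two) hh
  have hA2 : Integrable (fun z => A z ^ 2) G := integrable_sq_window c θ u Φ hX hX2 hh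
  -- `A² = ∫₀ʰ A · X∘Φ_s ds` pointwise (Bochner linearity)
  have e1 : ∀ z, A z ^ 2 = ∫ s in (0 : ℝ)..h, A z * X (Φ.flow s z) := by
    intro z
    rw [intervalIntegral.integral_const_mul, sq]
  -- Fubini on `G_N ⊗ (0, h]` for `(z, s) ↦ A z · X(Φ_s z)`
  have hint : Integrable (fun p : ℝ × Config (N + 1) (Fin 3) T3 => A p.2 * X (Φ.flow p.1 p.2))
      ((volume.restrict (Ioc (0 : ℝ) h)).prod G) := by
    have hflow2 := integrable_comp_flow_prod c θ u Φ (hX.pow_const 2) hX2.integrable_sq h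
    have hflow1 := integrable_comp_flow_prod c θ u Φ hX (hX2.integrable one_le_two) h
    have hstat : Integrable (fun p : ℝ × Config (N + 1) (Fin 3) T3 => A p.2 ^ 2)
        ((volume.restrict (Ioc (0 : ℝ) h)).prod G) := by
      simpa using (integrable_const (1 : ℝ)).mul_prod hA2
    have hAm : AEStronglyMeasurable (fun p : ℝ × Config (N + 1) (Fin 3) T3 => A p.2)
        ((volume.restrict (Ioc (0 : ℝ) h)).prod G) := by
      simpa using ((integrable_const (1 : ℝ)).mul_prod hAi).aestronglyMeasurable
    have hdom : Integrable (fun p : ℝ × Config (N + 1) (Fin 3) T3 =>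
        (A p.2 ^ 2 + X (Φ.flow p.1 p.2) ^ 2) / 2) ((volume.restrict (Ioc (0 : ℝ) h)).prod G) :=
      (hstat.add hflow2).div_const 2
    refine hdom.mono' (hAm.mul hflow1.aestronglyMeasurable) (Eventually.of_forall fun p => ?_)
    rw [Real.norm_eq_abs, abs_mul]
    nlinarith [sq_nonneg (|A p.2| - |X (Φ.flow p.1 p.2)|), sq_abs (A p.2), sq_abs (X (Φ.flow p.1 p.2)),
      abs_nonneg (A p.2), abs_nonneg (X (Φ.flow p.1 p.2))]
  have hint' : Integrable (Function.uncurry fun (z : Config (N + 1) (Fin 3) T3) (s : ℝ) =>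
      A z * X (Φ.flow s z)) (G.prod (volume.restrict (Ioc (0 : ℝ) h))) := hint.swap
  have e2 : ∫ z, A z ^ 2 ∂G = ∫ s in (0 : ℝ)..h, ∫ z, A z * X (Φ.flow s z) ∂G := by
    simp only [e1, intervalIntegral.integral_of_le hh]
    rw [integral_integral_swap hint']
  -- inner Fubini + stationarity, then the triangle reduction
  have e3 : ∫ s in (0 : ℝ)..h, ∫ z, A z * X (Φ.flow s z) ∂G = ∫ s in (0 : ℝ)..h, ∫ r in (0 : ℝ)..h, C |s - r| := by
    refine intervalIntegral.integral_congr fun s _ => ?_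
    exact integral_window_mul_flow_eq c θ u Φ hX hX2 hh s
  have e4 : ∫ s in (0 : ℝ)..h, ∫ r in (0 : ℝ)..h, C |s - r| = ∫ s in (0 : ℝ)..h, ∫ r in (0 : ℝ)..h, C |r - s| := by
    simp_rw [abs_sub_comm]
  rw [e2, e3, e4]
  exact double_integral_abs_eq (measurable_corr c θ u Φ hX)
    (fun t => abs_corr_le_integral_sq c θ u Φ hX hX2 t) hh

/-- **THE FEJÉR FORM OF THE KINETIC-WINDOW VARIANCE** (`ℝ≥0∞` shape of the item, window average): for
`h > 0`, `∫⁻ ofReal((h⁻¹∫₀ʰ X(Φ_r z) dr)²) dG_N = ofReal(2 h⁻² ∫₀ʰ (h − t) C(t) dt)`. [folklore] -/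
theorem lintegral_sq_windowAvg_eq_fejer (c θ : ℝ) (u : V3)
    (Φ : HardSphereFlow (Torus.geometry (Fin 3)) (hsDiameter σ N) (N + 1))
    [IsProbabilityMeasure (localGibbsLaw σ (fun _ => c) (fun _ => u) (fun _ => θ) N Φ)]
    {X : Config (N + 1) (Fin 3) T3 → ℝ} (hX : Measurable X)
    (hX2 : MemLp X 2 (localGibbsLaw σ (fun _ => c) (fun _ => u) (fun _ => θ) N Φ)) {h : ℝ} (hh : 0 < h) :
    ∫⁻ z, ENNReal.ofReal ((h⁻¹ * ∫ r in (0 : ℝ)..h, X (Φ.flow r z)) ^ 2)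
        ∂(localGibbsLaw σ (fun _ => c) (fun _ => u) (fun _ => θ) N Φ) =
      ENNReal.ofReal (2 * h⁻¹ ^ 2 * ∫ t in (0 : ℝ)..h, (h - t) * ∫ z, X z * X (Φ.flow t z)
        ∂(localGibbsLaw σ (fun _ => c) (fun _ => u) (fun _ => θ) N Φ)) := by
  set G := localGibbsLaw σ (fun _ => c) (fun _ => u) (fun _ => θ) N Φ with hGdef
  have hA2 : Integrable (fun z => (∫ r in (0 : ℝ)..h, X (Φ.flow r z)) ^ 2) G := integrable_sq_window c θ u Φ hX hX2 hh.le
  have e : (fun z => ENNReal.ofReal ((h⁻¹ * ∫ r in (0 : ℝ)..h, X (Φ.flow r z)) ^ 2)) =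
      fun z => ENNReal.ofReal (h⁻¹ ^ 2 * (∫ r in (0 : ℝ)..h, X (Φ.flow r z)) ^ 2) := by
    funext z; rw [mul_pow]
  rw [e, ← ofReal_integral_eq_lintegral_ofReal (hA2.const_mul _) (Eventually.of_forall fun z => by positivity),
    integral_const_mul, integral_sq_window_eq_fejer c θ u Φ hX hX2 hh.le]
  congr 1
  ring

/-- **THE GREEN–KUBO INEQUALITY** (`ℝ≥0∞` shape of the item): for `h > 0`,
`∫⁻ ofReal((h⁻¹∫₀ʰ X(Φ_r z) dr)²) dG_N ≤ ofReal(2 h⁻¹ ∫₀ʰ |C(t)| dt)` — the window variance is controlled by the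
Cesàro mean of the absolute autocorrelation (`(h − t) ≤ h` in the Fejér form). [folklore] -/
theorem lintegral_sq_windowAvg_le_cesaro_abs_corr (c θ : ℝ) (u : V3)
    (Φ : HardSphereFlow (Torus.geometry (Fin 3)) (hsDiameter σ N) (N + 1))
    [IsProbabilityMeasure (localGibbsLaw σ (fun _ => c) (fun _ => u) (fun _ => θ) N Φ)]
    {X : Config (N + 1) (Fin 3) T3 → ℝ} (hX : Measurable X)
    (hX2 : MemLp X 2 (localGibbsLaw σ (fun _ => c) (fun _ => u) (fun _ => θ) N Φ)) {h : ℝ} (hh : 0 < h) :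
    ∫⁻ z, ENNReal.ofReal ((h⁻¹ * ∫ r in (0 : ℝ)..h, X (Φ.flow r z)) ^ 2)
        ∂(localGibbsLaw σ (fun _ => c) (fun _ => u) (fun _ => θ) N Φ) ≤
      ENNReal.ofReal (2 * h⁻¹ * ∫ t in (0 : ℝ)..h, |∫ z, X z * X (Φ.flow t z)
        ∂(localGibbsLaw σ (fun _ => c) (fun _ => u) (fun _ => θ) N Φ)|) := by
  set G := localGibbsLaw σ (fun _ => c) (fun _ => u) (fun _ => θ) N Φ with hGdef
  set C : ℝ → ℝ := fun t => ∫ z, X z * X (Φ.flow t z) ∂G with hCdef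
  have hCm : Measurable C := measurable_corr c θ u Φ hX
  have hCb : ∀ t, |C t| ≤ ∫ z, X z ^ 2 ∂G := fun t => abs_corr_le_integral_sq c θ u Φ hX hX2 t
  have hCi : IntervalIntegrable C volume 0 h := Literature.Probability.Process.intervalIntegrable_of_bdd hCm hCb 0 h
  have hwCi : IntervalIntegrable (fun t => (h - t) * C t) volume 0 h :=
    hCi.continuousOn_mul (continuousOn_const.sub continuousOn_id)
  rw [lintegral_sq_windowAvg_eq_fejer c θ u Φ hX hX2 hh]
  refine ENNReal.ofReal_le_ofReal ?_
  have hle : ∫ t in (0 : ℝ)..h, (h - t) * C t ≤ ∫ t in (0 : ℝ)..h, h * |C t| := by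
    refine intervalIntegral.integral_mono_on hh.le hwCi (hCi.abs.const_mul h) fun t ht => ?_
    calc (h - t) * C t ≤ |(h - t) * C t| := le_abs_self _
      _ = (h - t) * |C t| := by rw [abs_mul, abs_of_nonneg (sub_nonneg.2 ht.2)]
      _ ≤ h * |C t| := mul_le_mul_of_nonneg_right (by linarith [ht.1]) (abs_nonneg _)
  rw [intervalIntegral.integral_const_mul] at hle
  calc 2 * h⁻¹ ^ 2 * ∫ t in (0 : ℝ)..h, (h - t) * C t ≤ 2 * h⁻¹ ^ 2 * (h * ∫ t in (0 : ℝ)..h, |C t|) :=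
        mul_le_mul_of_nonneg_left hle (by positivity)
    _ = 2 * h⁻¹ * ∫ t in (0 : ℝ)..h, |C t| := by field_simp

end Fejer

end EquilibriumStressVarianceDecayC3

end Summit.AtomisticToContinuum.HydrodynamicLimit.Theorems

end
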